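import Summits.BirchSwinnertonDyer.BirchSwinnertonDyer.Theorems.EisensteinDepletionAtTwoStarE1MNSFTwoPrints

/-!
# `DepletedLambdaLawAtTwoModNSFOfPrints` holds — E1M_NSF from the two prints of line `star` (re-export of p748463)

Route `route-BirchSwinnertonDyer-EisensteinDepletionAtTwo` (rev ≥ 21, tenure p2 GEN 52): the by-name support item
`DepletedLambdaLawAtTwoModNSFOfPrints : StarPrints → DepletedLambdaLawAtTwoModNSF`, where
`StarPrints := gamma1Parametrization_cuspImage_nonsingularReduction ∧ CalegariDimitrovTang2025_unboundedDenominators`, is closed by the landed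
conditional theorem `StarTwoPrints.depletedLambdaLawAtTwoModNSF_of_twoPrints` (p748463).  CONDITIONAL CONTENT ONLY: the two Literature facts
(F) and UBD remain statement-only named facts; BSD is not proved; the route's leaf is the rung-S0 door T-r3₂.
[cite: ConradEdixhovenStein2003, §6.1.2 proof of Lemma 6.1.6 (p. 381)] [cite: CalegariDimitrovTang2025, Thm. 1] [cite: GreenbergVatsal2000, §3 Thm. (3.12)] -/

namespace Summit.BirchSwinnertonDyer.BirchSwinnertonDyer.Theorems.DepletionAtTwo.StarTwoPrints

/-- The route item `DepletedLambdaLawAtTwoModNSFOfPrints` (E1M_NSF from the prints (F) + UBD), by re-export of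
`depletedLambdaLawAtTwoModNSF_of_twoPrints`. -/
theorem depletedLambdaLawAtTwoModNSFOfPrints_holds :
    Summit.BirchSwinnertonDyer.BirchSwinnertonDyer.Theses.EisensteinDepletionAtTwo.DepletedLambdaLawAtTwoModNSFOfPrints :=
  fun hP => depletedLambdaLawAtTwoModNSF_of_twoPrints hP.1 hP.2

end Summit.BirchSwinnertonDyer.BirchSwinnertonDyer.Theorems.DepletionAtTwo.StarTwoPrints
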